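import Literature.Analysis.FluidPDE.IsentropicEulerTorusUniqueness
import HarnessLib

/-!
# The periodic lift of a classical isentropic Euler solution on `𝕋³` solves the pointwise
# system on `ℝ³` (theorems only)

Topic `Literature/Analysis/FluidPDE`; namespace `Literature.Analysis.FluidPDE.IsentropicEuler`.
Converse bookkeeping of `IsentropicEulerPeriodicDescent.lean`: for a classical solution
`(ρ, u)` of the isentropic system on `[0, T) × 𝕋³` (`IsIsentropicEulerSolution γ T ρ u`), the
lifts `P(t, z) = ρ(t, proj z)`, `W(t, z) = u(t, proj z)` are jointly smooth on `[0, T) × ℝ³`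
and satisfy, at EVERY `t ∈ [0, T)` (one-sided time derivative within `[0, T)`) and every
`z ∈ ℝ³`, the pointwise equations
`∂ₜP + ∑ᵢ ∂ᵢ(P Wᵢ) = 0`, `P ∂ₜW + P (W·∇)W + ∇(P^γ/γ) = 0`
in exactly the form consumed by `isIsentropicEulerSolution_descend` and
`IsentropicEuler.glue_space` (`IsIsentropicEulerSolution.lift_smooth`,
`IsIsentropicEulerSolution.lift_equations`). THEOREMS ONLY, no new facts (D-0026).
[folklore] [cite: CaolaboraEtAl2025, Rem. 1.5 p. 7 (periodic setting)]
-/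

noncomputable section

open Set Filter Topology
open scoped ContDiff

namespace Literature.Analysis.FluidPDE

open Literature.MathematicalPhysics.KineticTheory (T3 V3)
open Literature.Analysis.FunctionSpaces

namespace IsentropicEuler

variable {γ T : ℝ} {ρ : ℝ → T3 → ℝ} {u : ℝ → T3 → V3}

/-- The lifts of a classical solution are jointly `C^∞` on `[0, T) × ℝ³` (this is the
definition of joint smoothness on the torus). [folklore] -/
theorem _root_.Literature.Analysis.FluidPDE.IsIsentropicEulerSolution.lift_smooth
    (h : IsIsentropicEulerSolution γ T ρ u) :
    ContDiffOn ℝ ∞ (fun p : ℝ × V3 => ρ p.1 (Torus.proj p.2)) (Ico 0 T ×ˢ univ) ∧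
      ContDiffOn ℝ ∞ (fun p : ℝ × V3 => u p.1 (Torus.proj p.2)) (Ico 0 T ×ˢ univ) :=
  ⟨h.smooth_density, h.smooth_velocity⟩

/-- **The lift solves the pointwise system on `ℝ³`.** For a classical isentropic solution on
`[0, T) × 𝕋³`, every `t ∈ [0, T)` and `z ∈ ℝ³`:
`∂ₜP + ∑ᵢ ∂ᵢ(P Wᵢ) = 0` and `P ∂ₜW + P ∑ᵢ Wᵢ ∂ᵢW + ∇(P^γ/γ) = 0` for the lifts
`P = ρ ∘ proj`, `W = u ∘ proj` (time derivative within `[0, T)`). [folklore] -/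
theorem _root_.Literature.Analysis.FluidPDE.IsIsentropicEulerSolution.lift_equations
    (h : IsIsentropicEulerSolution γ T ρ u) {t : ℝ} (ht : t ∈ Ico 0 T) (z : V3) :
    (derivWithin (fun s => ρ s (Torus.proj z)) (Ico 0 T) t +
      ∑ i, fderiv ℝ (fun w => ρ t (Torus.proj w) * u t (Torus.proj w) i) z
        (EuclideanSpace.single i 1) = 0) ∧
    (ρ t (Torus.proj z) • derivWithin (fun s => u s (Torus.proj z)) (Ico 0 T) t +
        ρ t (Torus.proj z) • ∑ i, u t (Torus.proj z) i •
          fderiv ℝ (fun w => u t (Torus.proj w)) z (EuclideanSpace.single i 1) +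
      gradient (fun w => ρ t (Torus.proj w) ^ γ / γ) z = 0) := by
  have hρs : Torus.IsSmooth (ρ t) := h.smooth_density.isSmooth_slice ht
  have hus : Torus.IsSmooth (u t) := h.smooth_velocity.isSmooth_slice ht
  have hu1 : Torus.IsContDiff 1 (u t) := hus.isContDiff (by simp)
  refine ⟨?_, ?_⟩
  · have hm := h.mass t ht (Torus.proj z)
    have hdiv : Torus.divergence (fun y => ρ t y • u t y) (Torus.proj z) =
        ∑ i, fderiv ℝ (fun w => ρ t (Torus.proj w) * u t (Torus.proj w) i) z
          (EuclideanSpace.single i 1) := by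
      simp only [Torus.divergence]
      refine Finset.sum_congr rfl fun i _ => ?_
      have hci : Torus.IsContDiff 1 (fun y => (ρ t y • u t y) i) :=
        ((hρs.smul' hus).apply i).isContDiff (by simp)
      rw [partialDeriv_proj_eq hci]
      have hfun : Torus.lift (fun y => (ρ t y • u t y) i) =
          fun w => ρ t (Torus.proj w) * u t (Torus.proj w) i := by
        funext w
        simp [Torus.lift_apply]
      rw [hfun]
    rw [hdiv] at hm
    exact hm
  · have hmo := h.momentum t ht (Torus.proj z)
    have hconv : ∑ i, u t (Torus.proj z) i • Torus.partialDeriv i (u t) (Torus.proj z) =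
        ∑ i, u t (Torus.proj z) i • fderiv ℝ (fun w => u t (Torus.proj w)) z
          (EuclideanSpace.single i 1) := by
      refine Finset.sum_congr rfl fun i _ => ?_
      rw [partialDeriv_proj_eq hu1]
      rfl
    have hgrad : Torus.gradient (fun y => ρ t y ^ γ / γ) (Torus.proj z) =
        gradient (fun w => ρ t (Torus.proj w) ^ γ / γ) z := by
      rw [gradient_proj_eq]
      rfl
    rw [hconv, hgrad] at hmo
    exact hmo

end IsentropicEuler

end Literature.Analysis.FluidPDE
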